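import Summits.HubbardSuperconductivity.HubbardSuperconductivity.Theorems.AnisotropyChordTransferFibre3

/-!
# Route `AnisotropyChord` / H0 rotor rung: HOLE₂ per-`L` certificates — the KERNEL CHECKER (fixed-point interval Birman–Schwinger test, zero data)

`TwoHoleGap L (3/4·ε₁)` (HOLE₂(.75), PORT PartN36 `…Fibre3LemmaVTargets`) is the one one-body spectral input of the GM₃ ∀L
assembly `gm3_of_hole2` (p1 g23).  By p2's PROP BS (`…Fibre3TwoHoleBS.twoHoleGap_of_matrixCert`) it follows, pair by pair, from
a finite positivity certificate on the ten points `ζ ∪ ∂ζ` built from the torus Green's function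
`G̃_g(r) = (1/V)Σ_{k≠0} cos(k·r)/(ε(k) − g)`; by p1's `twoHoleGap_of_reps` (`…Fibre3TwoHoleGapReduce`) the pairs `(0, s)` with `s`
in a set of `D₄`-representatives suffice.  This file is the COMPUTABLE half of a kernel proof of HOLE₂(.75) at a given `L`:
a checker `checkPair L s₁ s₂ : Bool` (and `checkReps L`) that the Lean kernel evaluates by `decide`; its soundness
(`checkPair = true ⇒ MatrixCert ⇒ TwoHoleGapRealAt`, `checkReps = true ⇒ TwoHoleGap L (3/4·eps1 L)`) is proved in
`…Fibre3Hole2Sound*`.  NO DATA: every number is computed in the kernel.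
* FIXED-POINT INTERVALS `Iv = ℤ × ℤ`, `(lo, hi)` meaning `[lo/D, hi/D]`, `D = 2^60`, outward rounding (`iadd`, `isub`, `imul`,
  `iinv`, `idivn`) — integer arithmetic only (kernel GMP), no `ℚ` normalisation in the hot loops;
* `cosIv L m ∋ cos(2πm/L)`: `π ∈ [piLo, piHi]` (20 digits, Mathlib `Real.pi_gt_d20/pi_lt_d20`), the quarter angle `πm/2L ≤ π/4` bracketed
  by the alternating Taylor sums of `cos` (8 / 9 terms; tree: `Literature.NumberTheory.LFunctions.VK.cos_taylor_brackets`, `y² ≤ 2`),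
  monotonicity of `cos` on `[0, π]`, then two angle doublings `cos 2y = 2cos²y − 1` in interval arithmetic;
* `gFix L = ⌈¾(D − cosLo(2π/L))⌉` — a rational `g_L = gFix/D ≥ ¾ε₁`, and the checks `g_L < ε₁`, `ε(k) − g_L > 0`;
* `greenIv` — the enclosure of `G̃_{g_L}(r)` as a double loop (row sums of depth `L`, so that no lazily built term is deeper than `2L`);
* per pair `(0, (s₁,s₂))`: the ten slot points (p2's `bsPt` order: centre, `+x, −x, +y, −y` per hole), coincidences (`repOf`), holes,
  the interval Green matrix, `E :=` the exact inverse of the midpoint Green matrix on representative slots rounded to fixed point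
  (ANY `E` is admissible — no correctness of the inversion is needed or claimed), the integer matrix
  `S2 = 2D²(E + Eᵀ) − Eᵀ·X2·E − D³·1` (`X2 = 2·mid + diag Σ(rad + radᵀ)` absorbs the enclosure radii), its aggregation `K2` onto
  representative live slots, and an exact rational `LDLᵀ` positivity test `psdCheck` (Schur complements; zero pivots allowed).
Cost: `O(V)` integer interval operations per Green value, `≤ 100` values per pair; `L = 9`: seconds per pair in the kernel.
Validated by a bit-identical Python mirror (prover's folder `scratch/fixcert.py`): all `D₄` classes pass for every `9 ≤ L ≤ 32`,
and the test FAILS exactly above the true gap (`L = 8`: passes at `.73ε₁`, fails at `.75ε₁`; `L = 9`: passes `.77`, fails `.78`;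
PartN36 table `.737 / .774`).
Prover seat `hubbard-h0-rotor-p3` g3; helper for stmt-HubbardSuperconductivity-19089 (`--supports`, helper class).
WHAT THIS IS NOT: nothing here proves superconductivity in the Hubbard model; the rotor TARGET as originally worded stays FALSE
(g15 verdict) — this is the computable half of per-`L` certificates for ONE input (HOLE₂) of ONE conditional reduction (rung 19089).
Mathlib + tree imports only; no sorry, no axioms, no `native_decide`.
-/

set_option linter.dupNamespace false
set_option autoImplicit false

open scoped BigOperators

namespace Summit.HubbardSuperconductivity.HubbardSuperconductivity.Theorems.AnisotropyChord.Transfer.Fibre3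

namespace Hole2

/-! ## Fixed-point interval arithmetic (denominator `D = 2^60`, outward rounding) -/

/-- the fixed-point denominator `D = 2^60`. [folklore] -/
def D : ℤ := 2 ^ 60

/-- a fixed-point interval `(lo, hi)`, meaning the real interval `[lo/D, hi/D]`. [folklore] -/
abbrev Iv : Type := ℤ × ℤ

/-- ceiling division by a positive integer (`/` on `ℤ` is floor division for positive divisors). [folklore] -/
def cdiv (a b : ℤ) : ℤ := -((-a) / b)

/-- interval sum. [folklore] -/
def iadd (x y : Iv) : Iv := (x.1 + y.1, x.2 + y.2)

/-- interval difference. [folklore] -/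
def isub (x y : Iv) : Iv := (x.1 - y.2, x.2 - y.1)

/-- interval product, rounded outward to the fixed-point grid. [folklore] -/
def imul (x y : Iv) : Iv :=
  (min (min (x.1 * y.1) (x.1 * y.2)) (min (x.2 * y.1) (x.2 * y.2)) / D,
   cdiv (max (max (x.1 * y.1) (x.1 * y.2)) (max (x.2 * y.1) (x.2 * y.2))) D)

/-- interval reciprocal of a POSITIVE interval (`0 < lo` is checked by the caller), rounded outward. [folklore] -/
def iinv (x : Iv) : Iv := (D * D / x.2, cdiv (D * D) x.1)

/-- interval divided by a positive integer, rounded outward. [folklore] -/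
def idivn (x : Iv) (n : ℤ) : Iv := (x.1 / n, cdiv x.2 n)

/-- entry `i` of a list of intervals (junk `(0,0)` out of range; every use is in range). [folklore] -/
def getIv (l : List Iv) (i : ℕ) : Iv := l.getD i (0, 0)

/-! ## Enclosures of `cos (2πm/L)` -/

/-- `π > piLo` (Mathlib `Real.pi_gt_d20`). [folklore] -/
def piLo : ℚ := 314159265358979323846 / 10 ^ 20

/-- `π < piHi` (Mathlib `Real.pi_lt_d20`). [folklore] -/
def piHi : ℚ := 314159265358979323847 / 10 ^ 20

/-- the even partial sum `Σ_{i<8} (−1)ⁱ y^{2i}/(2i)!` of `cos` — a LOWER bound of `cos y` for `y² ≤ 2`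
(alternating series; tree: `Literature.NumberTheory.LFunctions.VK.cos_taylor_brackets`). [folklore] -/
def taylorLo (y : ℚ) : ℚ := ∑ i ∈ Finset.range (2 * 4), (-1) ^ i * (y ^ (2 * i) / ((2 * i).factorial : ℚ))

/-- the odd partial sum `Σ_{i<9} (−1)ⁱ y^{2i}/(2i)!` of `cos` — an UPPER bound of `cos y` for `y² ≤ 2`. [folklore] -/
def taylorHi (y : ℚ) : ℚ := ∑ i ∈ Finset.range (2 * 4 + 1), (-1) ^ i * (y ^ (2 * i) / ((2 * i).factorial : ℚ))

/-- angle doubling on enclosures: `cos 2y = 2cos²y − 1`. [folklore] -/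
def idbl (x : Iv) : Iv := (2 * (imul x x).1 - D, 2 * (imul x x).2 - D)

/-- fixed-point enclosure of `cos(2πm/L)`, `m < L`: `m = 0 ↦ 1`, `2m = L ↦ −1`, `m > L/2 ↦` the mirror `m' = L − m`; otherwise the
quarter angle `y = πm'/(2L) ∈ [m'·piLo/2L, m'·piHi/2L] ⊂ [0, π/4]` is bracketed by the alternating Taylor sums (`cos` is decreasing
on `[0, π]`) and doubled twice. [folklore] -/
def cosIv (L m : ℕ) : Iv :=
  if m = 0 then (D, D) else
    if 2 * (if 2 * m ≤ L then m else L - m) = L then (-D, -D) else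
      idbl (idbl
        (⌊taylorLo (((if 2 * m ≤ L then m else L - m : ℕ) : ℚ) * piHi / (2 * L)) * (D : ℚ)⌋,
         ⌈taylorHi (((if 2 * m ≤ L then m else L - m : ℕ) : ℚ) * piLo / (2 * L)) * (D : ℚ)⌉))

/-- the table `[cosIv L 0, …, cosIv L (L−1)]`. [folklore] -/
def cosTab (L : ℕ) : List Iv := (List.range L).map (cosIv L)

/-- the Poincaré constant to certify, in fixed point: `gFix = ⌈¾(D − lo(cos 2π/L))⌉`, so `gFix/D ≥ ¾ε₁`. [folklore] -/
def gFix (L : ℕ) : ℤ := cdiv (3 * (D - (cosIv L 1).1)) 4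

/-! ## The Green's function `G̃_g(r) = (1/V) Σ_{k ≠ 0} cos(2π(k₁r₁ + k₂r₂)/L)/(ε(k) − g)` in interval arithmetic -/

/-- enclosure of `ε(k) − g = 2 − cos(2πk₁/L) − cos(2πk₂/L) − g`. [folklore] -/
def epsIv (ct : List Iv) (g : ℤ) (k1 k2 : ℕ) : Iv :=
  isub (isub (2 * D - g, 2 * D - g) (getIv ct k1)) (getIv ct k2)

/-- every `ε(k) − g`, `k ≠ 0`, has a positive lower bound (so that `iinv` is sound). [folklore] -/
def epsPos (L : ℕ) (ct : List Iv) (g : ℤ) : Bool :=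
  (List.range L).all fun k1 => (List.range L).all fun k2 =>
    (k1 == 0 && k2 == 0) || decide (0 < (epsIv ct g k1 k2).1)

/-- the table of enclosures of `1/(ε(k) − g)` (row `k₁`, column `k₂`; the `(0,0)` entry is never used). [folklore] -/
def einvTab (L : ℕ) (ct : List Iv) (g : ℤ) : List (List Iv) :=
  (List.range L).map fun k1 => (List.range L).map fun k2 => iinv (epsIv ct g k1 k2)

/-- one row `k₁` of the Green sum: `Σ_{k₂ < n, (k₁,k₂) ≠ 0} cos(2π(k₁r₁+k₂r₂)/L)·[1/(ε(k)−g)]` (accumulated downwards). [folklore] -/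
def gRow (L : ℕ) (ct erow : List Iv) (r1 r2 k1 : ℕ) : ℕ → Iv
  | 0 => (0, 0)
  | k2 + 1 =>
      if k1 = 0 ∧ k2 = 0 then gRow L ct erow r1 r2 k1 k2
      else iadd (gRow L ct erow r1 r2 k1 k2) (imul (getIv ct ((k1 * r1 + k2 * r2) % L)) (getIv erow k2))

/-- the Green sum over the rows `k₁ < n` (a spine of depth `n` over row sums of depth `L`). [folklore] -/
def gSum (L : ℕ) (ct : List Iv) (et : List (List Iv)) (r1 r2 : ℕ) : ℕ → Iv
  | 0 => (0, 0)
  | k1 + 1 => iadd (gSum L ct et r1 r2 k1) (gRow L ct (et.getD k1 []) r1 r2 k1 L)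

/-- enclosure of `G̃_g(r₁, r₂) = (1/L²) Σ_{k ≠ 0} cos(2π(k₁r₁ + k₂r₂)/L)/(ε(k) − g)`. [folklore] -/
def greenIv (L : ℕ) (ct : List Iv) (et : List (List Iv)) (r1 r2 : ℕ) : Iv :=
  idivn (gSum L ct et r1 r2 L) ((L : ℤ) * L)

/-! ## The pair `(0, s)`: ten slots, coincidences, holes -/

/-- the ten slot points of the pair `(0, (s₁,s₂))` as coordinates in `[0, L)²`: slots `0–4` = cluster of `0`, slots `5–9` =
cluster of `s`, each cluster ordered centre, `+x`, `−x`, `+y`, `−y` (p2's `bsPt`/`clusterPt`). [folklore] -/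
def slotPt (L s1 s2 p : ℕ) : ℕ × ℕ :=
  if p = 0 then (0, 0)
  else if p = 1 then (1 % L, 0)
  else if p = 2 then ((L - 1) % L, 0)
  else if p = 3 then (0, 1 % L)
  else if p = 4 then (0, (L - 1) % L)
  else if p = 5 then (s1 % L, s2 % L)
  else if p = 6 then ((s1 + 1) % L, s2 % L)
  else if p = 7 then ((s1 + (L - 1)) % L, s2 % L)
  else if p = 8 then (s1 % L, (s2 + 1) % L)
  else (s1 % L, (s2 + (L - 1)) % L)

/-- the slot carries a deleted point (`0` or `s`). [folklore] -/
def isHole (L s1 s2 p : ℕ) : Bool :=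
  (slotPt L s1 s2 p == (0, 0)) || (slotPt L s1 s2 p == (s1 % L, s2 % L))

/-- the representative slot of a point: the least slot carrying the same lattice point. [folklore] -/
def repOf (L s1 s2 p : ℕ) : ℕ :=
  ((List.range (p + 1)).find? fun q => slotPt L s1 s2 q == slotPt L s1 s2 p).getD p

/-- enclosure of the Green matrix entry `G̃_g(pt p − pt q)`. [folklore] -/
def gEntry (L : ℕ) (ct : List Iv) (et : List (List Iv)) (s1 s2 p q : ℕ) : Iv :=
  greenIv L ct et (((slotPt L s1 s2 p).1 + (L - (slotPt L s1 s2 q).1)) % L)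
    (((slotPt L s1 s2 p).2 + (L - (slotPt L s1 s2 q).2)) % L)

/-- the `10 × 10` interval Green matrix of the pair as a table. [folklore] -/
def gMat (L : ℕ) (ct : List Iv) (et : List (List Iv)) (s1 s2 : ℕ) : List (List Iv) :=
  (List.range 10).map fun p => (List.range 10).map fun q => gEntry L ct et s1 s2 p q

/-- table lookup in a `10 × 10` interval table. [folklore] -/
def getM (M : List (List Iv)) (p q : ℕ) : Iv := getIv (M.getD p []) q

/-- fixed-point midpoint (floor). [folklore] -/
def mid (x : Iv) : ℤ := (x.1 + x.2) / 2

/-- a radius bound around `mid`: `max (hi − mid) (mid − lo)`. [folklore] -/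
def rad (x : Iv) : ℤ := max (x.2 - mid x) (mid x - x.1)

/-! ## The charge map `E` (any matrix is admissible): exact inverse of the midpoint Green matrix on representative slots, rounded -/

/-- one Gauss–Jordan step on an augmented matrix (rows as lists): normalise row `c` by its pivot and clear column `c` elsewhere;
if the pivot vanishes the matrix is returned unchanged (no correctness is needed downstream). [folklore] -/
def gjStep (M : List (List ℚ)) (c : ℕ) : List (List ℚ) :=
  let rowc := M.getD c []
  let pv := rowc.getD c 0
  if pv = 0 then M else
    let rown := rowc.map (· / pv)
    (List.range M.length).map fun r =>
      if r = c then rown else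
        let rowr := M.getD r []
        let f := rowr.getD c 0
        List.zipWith (fun a b => a - f * b) rowr rown

/-- move a row with a nonzero entry in column `c` (at or below `c`) into position `c`. [folklore] -/
def gjPivot (M : List (List ℚ)) (c : ℕ) : List (List ℚ) :=
  match ((List.range M.length).filter fun r => c ≤ r && (M.getD r []).getD c 0 ≠ 0).head? with
  | none => M
  | some r =>
      if r = c then M else
        (List.range M.length).map fun i =>
          if i = c then M.getD r [] else if i = r then M.getD c [] else M.getD i []

/-- Gauss–Jordan inverse of a square rational matrix (junk if singular — harmless, `E` is arbitrary). [folklore] -/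
def gjInverse (A : List (List ℚ)) : List (List ℚ) :=
  let n := A.length
  let aug := (List.range n).map fun i =>
    (A.getD i []) ++ (List.range n).map fun j => if i = j then (1 : ℚ) else 0
  let red := (List.range n).foldl (fun M c => gjStep (gjPivot M c) c) aug
  red.map fun row => row.drop n

/-- the list of representative slots (points of `ζ ∪ ∂ζ` without repetition). [folklore] -/
def repSlots (L s1 s2 : ℕ) : List ℕ := (List.range 10).filter fun p => repOf L s1 s2 p == p

/-- position of a slot's representative in `repSlots`. [folklore] -/
def repIdx (L s1 s2 p : ℕ) : ℕ := (repSlots L s1 s2).findIdx (· == repOf L s1 s2 p)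

/-- the integer charge map `E` (fixed point, denominator `D`): on representative slots the rounded exact inverse of the midpoint
Green matrix of the distinct points, zero elsewhere. [folklore] -/
def eMat (L : ℕ) (G : List (List Iv)) (s1 s2 : ℕ) : ℕ → ℕ → ℤ :=
  let reps := repSlots L s1 s2
  let A : List (List ℚ) := reps.map fun p => reps.map fun q => ((mid (getM G p q) : ℚ) / (D : ℚ))
  let Ainv := gjInverse A
  fun p q =>
    if (repOf L s1 s2 p == p) && (repOf L s1 s2 q == q) then
      ⌊(Ainv.getD (repIdx L s1 s2 p) []).getD (repIdx L s1 s2 q) 0 * (D : ℚ)⌋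
    else 0

/-! ## The certificate matrices (exact integer arithmetic; `Finset` sums of ten terms) -/

/-- `X2 = 2·mid(G) + diag(Σ_q (rad_pq + rad_qp))` — `X2/(2D)` dominates the true Green matrix as a quadratic form. [folklore] -/
def x2Mat (G : List (List Iv)) (p q : ℕ) : ℤ :=
  2 * mid (getM G p q) + (if p = q then ∑ t ∈ Finset.range 10, (rad (getM G p t) + rad (getM G t p)) else 0)

/-- `S2 = 2D²(E + Eᵀ) − Eᵀ·X2·E − D³·1 = 2D³·S`, `S = E/D + (E/D)ᵀ − (E/D)ᵀ (X2/2D) (E/D) − ½`. [folklore] -/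
def s2Mat (E : ℕ → ℕ → ℤ) (X2 : ℕ → ℕ → ℤ) (p q : ℕ) : ℤ :=
  2 * D * D * (E p q + E q p)
    - (∑ a ∈ Finset.range 10, ∑ b ∈ Finset.range 10, E a p * X2 a b * E b q)
    - (if p = q then D * D * D else 0)

/-- aggregation of `S2` onto representative live slots: `K p q = Σ_{a ↦ p} Σ_{b ↦ q} S2 a b` over the live slots `a`, `b`
represented by `p`, `q` (zero when `p` or `q` represents no live slot). [folklore] -/
def kMat (L s1 s2 : ℕ) (S2 : ℕ → ℕ → ℤ) (p q : ℕ) : ℤ :=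
  ∑ a ∈ Finset.range 10, ∑ b ∈ Finset.range 10,
    (if repOf L s1 s2 a = p ∧ repOf L s1 s2 b = q ∧ isHole L s1 s2 a = false ∧ isHole L s1 s2 b = false
      then S2 a b else 0)

/-- the symmetrised aggregate `K2 = K + Kᵀ` read in `ℚ`. [folklore] -/
def k2Mat (K : ℕ → ℕ → ℤ) (p q : ℕ) : ℚ := ((K p q + K q p : ℤ) : ℚ)

/-! ## Exact positivity test by Schur complements -/

/-- Schur complement after eliminating index `0` (pivot `M 0 0 > 0`). [folklore] -/
def schur (M : ℕ → ℕ → ℚ) : ℕ → ℕ → ℚ := fun i j => M (i + 1) (j + 1) - M (i + 1) 0 * M 0 (j + 1) / M 0 0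

/-- the minor deleting index `0`. [folklore] -/
def minor0 (M : ℕ → ℕ → ℚ) : ℕ → ℕ → ℚ := fun i j => M (i + 1) (j + 1)

/-- tabulate an `n × n` function matrix (so that the kernel forces each entry once) and read it back (junk `0` out of range). [folklore] -/
def tab {α : Type} [Zero α] (n : ℕ) (M : ℕ → ℕ → α) : ℕ → ℕ → α :=
  fun i j => ((((List.range n).map fun i => (List.range n).map fun j => M i j).getD i []).getD j 0)

/-- `psdCheck n M`: the symmetric `n × n` matrix `M` is positive semidefinite — positive pivot ⇒ recurse on the Schur complement,
zero pivot ⇒ its row and column vanish and recurse on the minor, negative pivot ⇒ reject. [folklore] -/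
def psdCheck : ℕ → (ℕ → ℕ → ℚ) → Bool
  | 0, _ => true
  | n + 1, M =>
      if 0 < M 0 0 then psdCheck n (tab n (schur M))
      else if M 0 0 = 0 then
        ((List.range (n + 1)).all fun j => M 0 j == 0 && M j 0 == 0) && psdCheck n (tab n (minor0 M))
      else false

/-! ## The checks -/

/-- global sanity of the parameters: `3 ≤ L ≤ 2^40`, `0 < g_L < ε₁` (lower end of the enclosure), every `ε(k) − g_L > 0`. [folklore] -/
def checkParams (L : ℕ) : Bool :=
  decide (3 ≤ L) && decide (L ≤ 2 ^ 40) && decide (0 < gFix L) && decide (gFix L < D - (cosIv L 1).2)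
    && epsPos L (cosTab L) (gFix L)

/-- the symmetrised aggregate certificate matrix `K2` of the pair `(0, (s₁,s₂))` given the shared tables (read in `ℚ`). [folklore] -/
def k2Of (L : ℕ) (ct : List Iv) (et : List (List Iv)) (s1 s2 : ℕ) : ℕ → ℕ → ℚ :=
  k2Mat (kMat L s1 s2 (tab 10 (s2Mat (eMat L (gMat L ct et s1 s2) s1 s2) (x2Mat (gMat L ct et s1 s2)))))

/-- the per-pair certificate test for the pair `(0, (s₁, s₂))` given the shared tables: `s ≢ 0` and `K2 ⪰ 0`. [folklore] -/
def checkPairWith (L : ℕ) (ct : List Iv) (et : List (List Iv)) (s1 s2 : ℕ) : Bool :=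
  decide (¬ (s1 % L = 0 ∧ s2 % L = 0)) && psdCheck 10 (k2Of L ct et s1 s2)

/-- ★ the per-pair certificate: parameters are sane and the pair `(0, (s₁,s₂))`, `s ≠ 0`, passes the positivity test at `g_L`. [folklore] -/
def checkPair (L s1 s2 : ℕ) : Bool :=
  checkParams L && checkPairWith L (cosTab L) (einvTab L (cosTab L) (gFix L)) s1 s2

/-- the `D₄`-representatives of the separations: `0 ≤ y ≤ x ≤ L/2`, `(x,y) ≠ 0`. [folklore] -/
def repList (L : ℕ) : List (ℕ × ℕ) :=
  ((List.range (L / 2 + 1)).flatMap fun x => (List.range (x + 1)).map fun y => (x, y)).filter fun s => s ≠ (0, 0)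

/-- ★ all representative pairs at once (tables shared). [folklore] -/
def checkReps (L : ℕ) : Bool :=
  checkParams L &&
    (repList L).all fun s => checkPairWith L (cosTab L) (einvTab L (cosTab L) (gFix L)) s.1 s.2

end Hole2

end Summit.HubbardSuperconductivity.HubbardSuperconductivity.Theorems.AnisotropyChord.Transfer.Fibre3
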